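import Mathlib
import Summits.FinalStateConjecture.FinalStateConjecture.Theorems.PhotonSphereChannelsUniformPhotonSphereChannelsRPeelHardyTail

/-!
# Peeling, file 3: regularity bootstraps and the recessive seeds `w = exp ∫ W`

Support file for `stub_peel` of the line `crum-peeling-recessive-tower` (crux
`UniformPhotonSphereChannelsR`, stmt-FinalStateConjecture-14074).  On an open set / half-line
`S = (a, ∞)`:

* `contDiffOn_infty_of_deriv_eq` — a differentiable `f` with `f' = F(x, f)` for a smooth `F` is
  smooth (bootstrap); `contDiffOn_infty_of_deriv_deriv_eq` — the same for `u'' = Q u`;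
* `exists_seed` — for `W` smooth on `S` the seed `w = exp(∫_{a+1}^x W)` is smooth, positive, with
  `w' = W w`;
* `seed_ratio_le`, `seed_antitoneOn`, `seed_le_mul_rpow`, `seed_sq_integrableOn` — under the
  recessive normalisation `x W(x) ≤ −3/4` on `[X₁, ∞)` the seed decays at least like `x^{-3/4}`:
  `w(y) ≤ w(x) (y/x)^{-3/4}` for `X₁ ≤ x ≤ y`, `w` is non-increasing there, and `w ∈ L²(X, ∞)` for
  every `X > a`;
* two small shared tools: `integrableOn_sq_of_le` (domination of a square) and
  `hasDerivAt_rung_boundary` (the pointwise algebra `e − ẽ = (W(θ² + θ̃²))'` of a Darboux rung).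
-/

noncomputable section

-- the doubled `FinalStateConjecture` component is the tree's fixed summit/problem path
set_option linter.dupNamespace false

namespace Summit.FinalStateConjecture.FinalStateConjecture.Theorems.CrumPeelingRecessiveTower

open MeasureTheory Set Filter Topology intervalIntegral
open scoped ContDiff

/-! ### Regularity bootstraps -/

/-- **First-order bootstrap.** If `f` is differentiable on an open set `S` with
`f'(x) = F(x, f(x))` there, `F` smooth on `S × ℝ`, then `f` is smooth on `S`. -/
theorem contDiffOn_infty_of_deriv_eq {f : ℝ → ℝ} {F : ℝ → ℝ → ℝ} {S : Set ℝ} (hS : IsOpen S)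
    (hf : DifferentiableOn ℝ f S) (hF : ContDiffOn ℝ ∞ (Function.uncurry F) (S ×ˢ univ))
    (hderiv : ∀ x ∈ S, deriv f x = F x (f x)) : ContDiffOn ℝ ∞ f S := by
  have key : ∀ k : ℕ, ContDiffOn ℝ k f S := by
    intro k
    induction k with
    | zero => exact_mod_cast contDiffOn_zero.2 hf.continuousOn
    | succ k ih =>
      have hk : ContDiffOn ℝ k (fun x => F x (f x)) S := by
        have hmap : MapsTo (fun x => (x, f x)) S (S ×ˢ univ) := fun x hx => ⟨hx, mem_univ _⟩
        have h1 : ContDiffOn ℝ k (fun x : ℝ => (x, f x)) S := contDiffOn_id.prodMk ih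
        exact ((hF.of_le (by exact_mod_cast le_top)).comp h1 hmap :)
      rw [show ((k + 1 : ℕ) : WithTop ℕ∞) = (k : WithTop ℕ∞) + 1 by push_cast; rfl,
        contDiffOn_succ_iff_deriv_of_isOpen hS]
      refine ⟨hf, fun h => ?_, hk.congr fun x hx => hderiv x hx⟩
      exact absurd h (by exact_mod_cast WithTop.coe_ne_top)
  exact contDiffOn_infty.2 key

/-- **Second-order bootstrap.** If `u` and `u'` are differentiable on an open set `S` with
`u'' = Q u` there, `Q` smooth on `S`, then `u` is smooth on `S`. -/
theorem contDiffOn_infty_of_deriv_deriv_eq {u Q : ℝ → ℝ} {S : Set ℝ} (hS : IsOpen S)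
    (hu : DifferentiableOn ℝ u S) (hu' : DifferentiableOn ℝ (deriv u) S)
    (hQ : ContDiffOn ℝ ∞ Q S) (hderiv : ∀ x ∈ S, deriv (deriv u) x = Q x * u x) :
    ContDiffOn ℝ ∞ u S := by
  have key : ∀ k : ℕ, ContDiffOn ℝ k u S ∧ ContDiffOn ℝ k (deriv u) S := by
    intro k
    induction k with
    | zero =>
      exact ⟨by exact_mod_cast contDiffOn_zero.2 hu.continuousOn,
        by exact_mod_cast contDiffOn_zero.2 hu'.continuousOn⟩
    | succ k ih =>
      have hcast : ((k + 1 : ℕ) : WithTop ℕ∞) = (k : WithTop ℕ∞) + 1 := by push_cast; rfl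
      have h2 : ContDiffOn ℝ k (fun x => Q x * u x) S :=
        (hQ.of_le (by exact_mod_cast le_top)).mul ih.1
      have hd' : ContDiffOn ℝ (k + 1 : ℕ) (deriv u) S := by
        rw [hcast, contDiffOn_succ_iff_deriv_of_isOpen hS]
        exact ⟨hu', fun h => absurd h (by exact_mod_cast WithTop.coe_ne_top),
          h2.congr fun x hx => hderiv x hx⟩
      have hd : ContDiffOn ℝ (k + 1 : ℕ) u S := by
        rw [hcast, contDiffOn_succ_iff_deriv_of_isOpen hS]
        exact ⟨hu, fun h => absurd h (by exact_mod_cast WithTop.coe_ne_top), ih.2⟩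
      exact ⟨hd, hd'⟩
  exact contDiffOn_infty.2 fun k => (key k).1

/-! ### The recessive seed -/

/-- **The seed `w = exp(∫_{a+1}^x W)`.**  For `W` smooth on `(a, ∞)` there is a smooth positive
`w` on `(a, ∞)` with `w' = W w` there. -/
theorem exists_seed {W : ℝ → ℝ} {a : ℝ} (hW : ContDiffOn ℝ ∞ W (Ioi a)) :
    ∃ w : ℝ → ℝ, (∀ x, a < x → 0 < w x) ∧ (∀ x, a < x → HasDerivAt w (W x * w x) x) ∧
      ContDiffOn ℝ ∞ w (Ioi a) := by
  have hWc : ContinuousOn W (Ioi a) := hW.continuousOn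
  set I : ℝ → ℝ := fun x => ∫ y in (a + 1)..x, W y with hI
  have hId : ∀ x, a < x → HasDerivAt I (W x) x := by
    intro x hx
    have hint : IntervalIntegrable W volume (a + 1) x := by
      refine (hWc.mono ?_).intervalIntegrable
      intro y hy
      rcases le_total (a + 1) x with h | h
      · rw [uIcc_of_le h] at hy; exact lt_of_lt_of_le (by linarith) hy.1
      · rw [uIcc_of_ge h] at hy; exact lt_of_lt_of_le hx hy.1
    exact intervalIntegral.integral_hasDerivAt_right hint
      (hWc.stronglyMeasurableAtFilter isOpen_Ioi x hx) (hWc.continuousAt (Ioi_mem_nhds hx))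
  set w : ℝ → ℝ := fun x => Real.exp (I x) with hw
  have hwd : ∀ x, a < x → HasDerivAt w (W x * w x) x := by
    intro x hx
    have h := (hId x hx).exp
    simp only [hw]
    convert h using 1
    ring
  refine ⟨w, fun x _ => Real.exp_pos _, hwd, ?_⟩
  refine contDiffOn_infty_of_deriv_eq (F := fun x y => W x * y) isOpen_Ioi
    (fun x hx => (hwd x hx).differentiableAt.differentiableWithinAt) ?_
    fun x hx => (hwd x hx).deriv
  exact (hW.comp contDiffOn_fst (fun p hp => (mem_prod.1 hp).1)).mul contDiffOn_snd

/-- **Recessive decay of the seed, ratio form.** If `w > 0` with `w' = W w` on `(a, ∞)` and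
`x W(x) ≤ −3/4` on `[X₁, ∞)` (`a < X₁`, `0 < X₁`), then `w(y) ≤ w(x) (y/x)^{-3/4}` for
`X₁ ≤ x ≤ y`. -/
theorem seed_ratio_le {W w : ℝ → ℝ} {a X₁ : ℝ} (haX : a < X₁) (hX0 : 0 < X₁)
    (hw0 : ∀ x, a < x → 0 < w x) (hwd : ∀ x, a < x → HasDerivAt w (W x * w x) x)
    (hrec : ∀ x, X₁ ≤ x → x * W x ≤ -3 / 4) {x y : ℝ} (hx : X₁ ≤ x) (hxy : x ≤ y) :
    w y ≤ w x * (y / x) ^ (-(3 : ℝ) / 4) := by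
  -- `g = log w + (3/4) log` is non-increasing on `[X₁, ∞)`
  set g : ℝ → ℝ := fun s => Real.log (w s) + (3 / 4) * Real.log s with hg
  have hgd : ∀ s, X₁ ≤ s → HasDerivAt g (W s + (3 / 4) * s⁻¹) s := by
    intro s hs
    have hs0 : 0 < s := hX0.trans_le hs
    have hsa : a < s := haX.trans_le hs
    have h1 : HasDerivAt (fun s => Real.log (w s)) (W s) s := by
      have h := (hwd s hsa).log (hw0 s hsa).ne'
      rwa [mul_div_assoc, div_self (hw0 s hsa).ne', mul_one] at h
    have h2 : HasDerivAt (fun s => (3 / 4) * Real.log s) ((3 / 4) * s⁻¹) s :=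
      (Real.hasDerivAt_log hs0.ne').const_mul _
    exact h1.add h2
  have hanti : AntitoneOn g (Ici X₁) := by
    refine antitoneOn_of_deriv_nonpos (convex_Ici X₁)
      (fun s hs => (hgd s hs).continuousAt.continuousWithinAt)
      (fun s hs => (hgd s (interior_subset hs)).differentiableAt.differentiableWithinAt)
      fun s hs => ?_
    rw [interior_Ici] at hs
    have hs' : X₁ ≤ s := le_of_lt hs
    have hs0 : 0 < s := hX0.trans_le hs'
    rw [(hgd s hs').deriv]
    have h := hrec s hs'
    have : W s + 3 / 4 * s⁻¹ = (s * W s + 3 / 4) / s := by field_simp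
    rw [this]
    exact div_nonpos_of_nonpos_of_nonneg (by linarith) hs0.le
  have hgy := hanti (show X₁ ≤ x from hx) (show X₁ ≤ y from hx.trans hxy) hxy
  have hx0 : 0 < x := hX0.trans_le hx
  have hy0 : 0 < y := hx0.trans_le hxy
  have hwx := hw0 x (haX.trans_le hx)
  have hwy := hw0 y (haX.trans_le (hx.trans hxy))
  simp only [hg] at hgy
  -- exponentiate
  have hlog : Real.log (w y) ≤ Real.log (w x * (y / x) ^ (-(3 : ℝ) / 4)) := by
    rw [Real.log_mul hwx.ne' (Real.rpow_pos_of_pos (div_pos hy0 hx0) _).ne',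
      Real.log_rpow (div_pos hy0 hx0), Real.log_div hy0.ne' hx0.ne']
    linarith
  exact (Real.log_le_log_iff hwy (mul_pos hwx (Real.rpow_pos_of_pos (div_pos hy0 hx0) _))).1 hlog

/-- Under the recessive normalisation the seed is non-increasing on `[X₁, ∞)`. -/
theorem seed_antitoneOn {W w : ℝ → ℝ} {a X₁ : ℝ} (haX : a < X₁) (hX0 : 0 < X₁)
    (hw0 : ∀ x, a < x → 0 < w x) (hwd : ∀ x, a < x → HasDerivAt w (W x * w x) x)
    (hrec : ∀ x, X₁ ≤ x → x * W x ≤ -3 / 4) : AntitoneOn w (Ici X₁) := by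
  refine antitoneOn_of_deriv_nonpos (convex_Ici X₁)
    (fun s hs => (hwd s (haX.trans_le hs)).continuousAt.continuousWithinAt)
    (fun s hs => (hwd s (haX.trans_le (interior_subset hs))).differentiableAt.differentiableWithinAt)
    fun s hs => ?_
  rw [interior_Ici] at hs
  have hs' : X₁ ≤ s := le_of_lt hs
  have hs0 : 0 < s := hX0.trans_le hs'
  rw [(hwd s (haX.trans_le hs')).deriv]
  have hW : W s ≤ 0 := by
    have h := hrec s hs'
    by_contra hpos
    have : 0 < s * W s := mul_pos hs0 (lt_of_not_ge hpos)
    linarith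
  exact mul_nonpos_of_nonpos_of_nonneg hW (hw0 s (haX.trans_le hs')).le

/-- Power decay of the seed: `w(y) ≤ (w(X₁) X₁^{3/4}) · y^{-3/4}` for `y ≥ X₁`. -/
theorem seed_le_mul_rpow {W w : ℝ → ℝ} {a X₁ : ℝ} (haX : a < X₁) (hX0 : 0 < X₁)
    (hw0 : ∀ x, a < x → 0 < w x) (hwd : ∀ x, a < x → HasDerivAt w (W x * w x) x)
    (hrec : ∀ x, X₁ ≤ x → x * W x ≤ -3 / 4) {y : ℝ} (hy : X₁ ≤ y) :
    w y ≤ (w X₁ * X₁ ^ ((3 : ℝ) / 4)) * y ^ (-(3 : ℝ) / 4) := by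
  have h := seed_ratio_le haX hX0 hw0 hwd hrec le_rfl hy
  have hy0 : 0 < y := hX0.trans_le hy
  have hexp : (-(3 : ℝ) / 4) = -((3 : ℝ) / 4) := by ring
  have e : (y / X₁) ^ (-(3 : ℝ) / 4) = X₁ ^ ((3 : ℝ) / 4) * y ^ (-(3 : ℝ) / 4) := by
    rw [hexp, Real.div_rpow hy0.le hX0.le, Real.rpow_neg hX0.le, div_inv_eq_mul, mul_comm]
  rw [e] at h
  calc w y ≤ w X₁ * (X₁ ^ ((3 : ℝ) / 4) * y ^ (-(3 : ℝ) / 4)) := h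
    _ = (w X₁ * X₁ ^ ((3 : ℝ) / 4)) * y ^ (-(3 : ℝ) / 4) := by ring

/-- **Square integrability of the seed**: `w ∈ L²(X, ∞)` for every `X > a`. -/
theorem seed_sq_integrableOn {W w : ℝ → ℝ} {a X₁ : ℝ} (haX : a < X₁) (hX0 : 0 < X₁)
    (hw0 : ∀ x, a < x → 0 < w x) (hwd : ∀ x, a < x → HasDerivAt w (W x * w x) x)
    (hrec : ∀ x, X₁ ≤ x → x * W x ≤ -3 / 4) {X : ℝ} (hX : a < X) :
    IntegrableOn (fun x => w x ^ 2) (Ioi X) := by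
  have hwc : ContinuousOn w (Ioi a) := fun x hx => (hwd x hx).continuousAt.continuousWithinAt
  have hw2c : ContinuousOn (fun x => w x ^ 2) (Ioi a) := hwc.pow 2
  set C : ℝ := w X₁ * X₁ ^ ((3 : ℝ) / 4) with hC
  -- on `(X₁, ∞)` by comparison with `C² y^{-3/2}`
  have hfar : IntegrableOn (fun x => w x ^ 2) (Ioi X₁) := by
    have hdom : IntegrableOn (fun y : ℝ => C ^ 2 * y ^ (-(3 : ℝ) / 2)) (Ioi X₁) :=
      (integrableOn_Ioi_rpow_of_lt (by norm_num : (-(3 : ℝ) / 2) < -1) hX0).const_mul _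
    refine hdom.mono' ((hw2c.mono (Ioi_subset_Ioi haX.le)).aestronglyMeasurable measurableSet_Ioi)
      ?_
    filter_upwards [ae_restrict_mem measurableSet_Ioi] with y hy
    have hy' : X₁ ≤ y := le_of_lt hy
    have hy0 : 0 < y := hX0.trans hy
    have hwy : 0 < w y := hw0 y (haX.trans hy)
    have hle := seed_le_mul_rpow haX hX0 hw0 hwd hrec hy'
    rw [Real.norm_eq_abs, abs_of_nonneg (sq_nonneg _), ← rpow_neg_three_quarters_sq hy0, ← mul_pow]
    exact pow_le_pow_left₀ hwy.le hle 2
  rcases le_or_gt X₁ X with h | h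
  · exact hfar.mono_set (Ioi_subset_Ioi h)
  · exact integrableOn_Ioi_of_continuousOn_Icc
      (hw2c.mono fun x hx => lt_of_lt_of_le hX hx.1) hfar

/-! ### Two small tools shared by the energy files -/

/-- Domination helper: a function continuous on `(a, ∞)` whose square is pointwise bounded on
`(X, ∞)` (`X ≥ a`) by an integrable function is square integrable there. -/
theorem integrableOn_sq_of_le {f g : ℝ → ℝ} {a X : ℝ} (haX : a ≤ X) (hf : ContinuousOn f (Ioi a))
    (hg : IntegrableOn g (Ioi X)) (hle : ∀ x, X < x → f x ^ 2 ≤ g x) :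
    IntegrableOn (fun x => f x ^ 2) (Ioi X) := by
  refine hg.mono' (((hf.mono (Ioi_subset_Ioi haX)).pow 2).aestronglyMeasurable measurableSet_Ioi) ?_
  filter_upwards [ae_restrict_mem measurableSet_Ioi] with x hx
  rw [Real.norm_eq_abs, abs_of_nonneg (sq_nonneg _)]
  exact hle x hx

/-- **Pointwise rung identity** `e − ẽ = (W(θ² + θ̃²))'`, as a `HasDerivAt` statement at a point:
pure algebra from the two first-order relations of the rung and `W' = U − W²`, `Ũ = 2W² − U`. -/
theorem hasDerivAt_rung_boundary {W : ℝ → ℝ} {f g : ℝ → ℝ} {x Wx Ux Utx f' g' ft gt : ℝ}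
    (hW : HasDerivAt W (Ux - Wx ^ 2) x) (hWx : W x = Wx) (hUt : Utx = 2 * Wx ^ 2 - Ux)
    (hf : HasDerivAt f f' x) (hg : HasDerivAt g g' x)
    (hRt : gt = f' - Wx * f x) (hRx : g' = ft - Wx * g x) :
    HasDerivAt (fun y => W y * (f y ^ 2 + g y ^ 2))
      ((ft ^ 2 + f' ^ 2 + Ux * f x ^ 2) - (gt ^ 2 + g' ^ 2 + Utx * g x ^ 2)) x := by
  have h : HasDerivAt (fun y => W y * (f y ^ 2 + g y ^ 2))
      ((Ux - Wx ^ 2) * (f x ^ 2 + g x ^ 2) + W x * (↑2 * f x ^ (2 - 1) * f' + ↑2 * g x ^ (2 - 1) * g')) x :=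
    hW.mul ((hf.pow 2).add (hg.pow 2))
  refine h.congr_deriv ?_
  simp only [Nat.add_one_sub_one, pow_one]
  rw [hWx, hUt, hRt, hRx]
  ring

/-- Registered sub-goal `peel_seedDecay` of `stub_peel` (verbatim signature): power decay `w ≤ C x^{-3/4}` of a recessive seed. -/
theorem peel_seedDecay : ∀ (W w : ℝ → ℝ) (a X₁ : ℝ), a < X₁ → 0 < X₁ → (∀ x, a < x → 0 < w x) → (∀ x, a < x → HasDerivAt w (W x * w x) x) → (∀ x, X₁ ≤ x → x * W x ≤ -3 / 4) → ∀ y : ℝ, X₁ ≤ y → w y ≤ (w X₁ * X₁ ^ ((3 : ℝ) / 4)) * y ^ (-(3 : ℝ) / 4) :=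
  fun _ _ _ _ haX hX0 hw0 hwd hrec _ hy => seed_le_mul_rpow haX hX0 hw0 hwd hrec hy

end Summit.FinalStateConjecture.FinalStateConjecture.Theorems.CrumPeelingRecessiveTower
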